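import Summits.AtomisticToContinuum.FouriersLaw.Theses.MatthiessenLadder
import Summits.AtomisticToContinuum.FouriersLaw.Theorems.MatthiessenLadderPrefixSteadyStatesStubSteadyStateOfSemigroupBound
import Summits.AtomisticToContinuum.FouriersLaw.Theorems.MatthiessenLadderPrefixSteadyStatesStubHarmonicNessUnique
import Summits.AtomisticToContinuum.FouriersLaw.Theorems.MatthiessenLadderPrefixSteadyStatesStubPrefixResponseZero
import Summits.AtomisticToContinuum.FouriersLaw.Theorems.MatthiessenLadderPrefixSteadyStatesStubCellChainSmoothDensity
import Summits.AtomisticToContinuum.FouriersLaw.Theorems.MatthiessenLadderPrefixSteadyStatesStubCellChainInvariantUnique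
import Summits.AtomisticToContinuum.FouriersLaw.Theorems.MatthiessenLadderPrefixSteadyStatesStubCellChainInvariantOfSteadyState
import Summits.AtomisticToContinuum.FouriersLaw.Theorems.MatthiessenLadderPrefixSteadyStatesStubPrefixResponseOfUniformMixing
import Summits.AtomisticToContinuum.FouriersLaw.Theorems.MatthiessenLadderPrefixSteadyStatesStubPrefixWindowDecay
import Summits.AtomisticToContinuum.FouriersLaw.Theorems.MatthiessenLadderPrefixSteadyStatesStubPrefixExpBound
import Summits.AtomisticToContinuum.FouriersLaw.Theorems.MatthiessenLadderPrefixSteadyStatesStubPrefixEnergyScale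
import Summits.AtomisticToContinuum.FouriersLaw.Theorems.MatthiessenLadderPrefixSteadyStatesStubPrefixHostObservability
import Summits.AtomisticToContinuum.FouriersLaw.Theorems.MatthiessenLadderPrefixSteadyStatesStubPrefixMixingOfDecay
import Summits.AtomisticToContinuum.FouriersLaw.Theorems.MatthiessenLadderPrefixSteadyStatesStubPrefixLimitDissipation
import Summits.AtomisticToContinuum.FouriersLaw.Theorems.MatthiessenLadderPrefixSteadyStatesStubPrefixUniformDecay
import Summits.AtomisticToContinuum.FouriersLaw.Theorems.MatthiessenLadderPrefixSteadyStatesStubPrefixCesaroEnergyBoundR17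
import Summits.AtomisticToContinuum.FouriersLaw.Theorems.MatthiessenLadderPrefixSteadyStatesStubPrefixUniformMixingR17
import Literature.MathematicalPhysics.KineticTheory.CellChainLangevin
import Literature.MathematicalPhysics.KineticTheory.SiteChainLyapunovInvariant
import Literature.MathematicalPhysics.KineticTheory.HarmonicChainNESS
import Literature.Probability.Process.BrownianSupTail

/-!
# Crux `PrefixSteadyStates` of route `MatthiessenLadder` — PROVED (line `registered`, lead c3, r17)

Unit `line-stmt-AtomisticToContinuum-12778-c3`; target
`Summit.AtomisticToContinuum.FouriersLaw.Theses.MatthiessenLadder.PrefixSteadyStates`: for every `k` the prefix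
rung `cellChain ω₂ lam β γ (· < k)` (first `k` cells quartic, harmonic pinned host behind) has, at every size `N`
and all temperatures, a unique steady state in the weak Fokker–Planck class and a response coefficient.

Composition `PrefixSteadyStates_of` (sorry-free): the harmonic regime `k = 0` (pinned harmonic host — the
explicit Gaussian `harmonicNESS` + landed `stub_harmonicNessUnique`), the saturated regime `N ≤ k` (the rung IS
the pinned chain: `FiniteChainSteadyStates_holds` + landed `stub_prefixResponseZero`), and the MIXED regime
`0 < k < N`: existence from `cellChain_exists_fellerSemigroup` + the Cesàro energy bound
(`stub_prefixCesaroEnergyBoundR17`, from the landed decay `stub_prefixUniformDecay` = CEHR Thm 5.1 for the mixed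
rung, the new mathematics of this crux) through `stub_steadyStateOfSemigroupBound`; uniqueness from
`stub_cellChainInvariantOfSteadyState` + `stub_cellChainSmoothDensity` + `stub_cellChainInvariantUnique`; response
from `stub_prefixUniformMixingR17` (decay + (3.4) + uniform Harris) through `stub_prefixResponseOfUniformMixing`.
All fourteen registered stubs are landed under `Theorems/MatthiessenLadderPrefixSteadyStatesStub*.lean`.

References: Cuneo–Eckmann–Hairer–Rey-Bellet, EJP 23 (2018) no. 55; Carmona, Ann. IHP B 43 (2007);
Hairer–Mattingly, CPAM 62 (2009); Eckmann–Pillet–Rey-Bellet, CMP 201 (1999); Rey-Bellet–Thomas, CMP 225 (2002).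
-/

noncomputable section

namespace Summit.AtomisticToContinuum.FouriersLaw.Theorems.MatthiessenLadderPrefixSteadyStates

open MeasureTheory Filter Topology
open scoped NNReal ENNReal BoundedContinuousFunction ContDiff
open Literature.MathematicalPhysics.KineticTheory.HeatConduction
open Summit.AtomisticToContinuum.FouriersLaw.Theses.MatthiessenLadder (PrefixSteadyStates)

/-! The Langevin semigroup of every cell chain (`cellChain_uniformlyConfining`, `cellChain_exists_fellerSemigroup`) is
LANDED: `Literature/MathematicalPhysics/KineticTheory/CellChainLangevin.lean` (p147636). -/


/-! ### The stubs (all LANDED — no `sorry` in this file)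

Reshape r12 (lead c3, wave 3). The ONE piece of new mathematics — CEHR Theorem 5.1 (the high-energy decay
of `e^{θH}`) for the MIXED rung — is `stub_prefixUniformDecay`; everything else that the two former stubs
`stub_prefixCesaroEnergyBound` / `stub_prefixUniformMixing` contained is now either PROVED below from it
(`prefixCesaroEnergyBound_of_stubs`, `prefixUniformMixing_of_stubs`) or registered as a worker-sized PORT of
in-tree pinned-chain theory to the cell chains: `stub_prefixExpBound` (CEHR (3.4)), `stub_prefixMixingOfDecay`
(uniform Harris: decay + (3.4) ⇒ CEHR (2.5) uniformly in the bias), and the four INPUTS of the lead's proof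
plan for `stub_prefixUniformDecay` (MEMO-EnergyBound.md §7, the two-block argument): `stub_prefixEnergyScale`
(pathwise energy bookkeeping at scale `K⁴`, port of `LangevinChainEnergyScale`), `stub_prefixWindowDecay`
(the probabilistic shell, port of `LangevinChainH2.pinnedChain_window_decay_of_pathwise`),
`stub_prefixLimitDissipation` (CEHR Prop. 5.14 for the rescaled CELL block `[0,k]`, port of
`LangevinChainLimitFlow`), `stub_prefixHostObservability` (NEW, elementary: observability of the damped
harmonic HOST block `(k,N)` from the right bath, with the interface site as a bounded forcing). -/

/-! `stub_prefixUniformDecay` (Stub D, r12: CEHR Thm 5.1 for the MIXED rung with a temperature ceiling — THE new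
mathematics of the crux) is LANDED: `Summits/AtomisticToContinuum/FouriersLaw/Theorems/MatthiessenLadderPrefixSteadyStatesStubPrefixUniformDecay.lean`
(p160001; the lead's two-block proof: Literature PrefixRungScaling p154996, PrefixRungPerturbation p155439,
PrefixRungScaleCloseness p156163, PrefixRungEnergyBlocks p156819, PrefixRungHostBlock p157401, PrefixRungCellGain p157877,
PrefixRungHostGain p158471, PrefixRungAccounting p159477), imported above. -/

/-! `stub_prefixExpBound` (Stub X, r12: CEHR (3.4)) is LANDED: p155391,
`Summits/AtomisticToContinuum/FouriersLaw/Theorems/MatthiessenLadderPrefixSteadyStatesStubPrefixExpBound.lean`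
(+ Literature/MathematicalPhysics/KineticTheory/SiteChainExpBound.lean p154768, generic), imported above. -/

/-! `stub_prefixEnergyScale` (Stub S, r12: pathwise energy bookkeeping at scale `K⁴`) is LANDED: p155673,
`Summits/AtomisticToContinuum/FouriersLaw/Theorems/MatthiessenLadderPrefixSteadyStatesStubPrefixEnergyScale.lean`
(+ Literature SiteChainPathwiseEnergy p154789, CellChainEnergyScale p154872, CellChainEnergyFlow p155394 —
`cellChain_drivenFlow_energyScale` with the explicit constants `pinnedChainScaleA/B/C`), imported above. -/

/-! `stub_prefixWindowDecay` (Stub W, r12) is LANDED: p155130,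
`Summits/AtomisticToContinuum/FouriersLaw/Theorems/MatthiessenLadderPrefixSteadyStatesStubPrefixWindowDecay.lean`
(+ Literature/MathematicalPhysics/KineticTheory/SiteChainWindowDecay.lean p154635, generic for every
`UniformlyConfining` site chain), imported above. -/

/-! `stub_prefixLimitDissipation` (Stub L, r12: CEHR Prop. 5.14 for the (k+1)-site limit cell chain) is LANDED:
p156407, `Summits/AtomisticToContinuum/FouriersLaw/Theorems/MatthiessenLadderPrefixSteadyStatesStubPrefixLimitDissipation.lean`
(+ Literature SiteChainHamiltonianFlow p154931, SiteChainQuarticDissipation p155621), imported above. -/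

/-! `stub_prefixHostObservability` (Stub O, r12, NEW: observability of the damped harmonic host block
with the interface as bounded forcing) is LANDED: p155574,
`Summits/AtomisticToContinuum/FouriersLaw/Theorems/MatthiessenLadderPrefixSteadyStatesStubPrefixHostObservability.lean`
(+ Literature/Analysis/ODE/LinearObservability.lean p154937, Literature/…/DampedHarmonicBlockObservability.lean
p155384), imported above. -/

/-- **A Feller semigroup of the MIXED rung with a Cesàro-bounded `(1+H)²`-orbit** (the r1–r3 hard
stub, PROVED from `cellChain_exists_fellerSemigroup` + `prefixCesaroEnergyBound_of_stubs`). -/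
theorem prefixSemigroupEnergyBound_of_stubs :
    ∀ ω₂ lam β γ : ℝ, 0 < ω₂ → 0 < lam → 0 < β → 0 < γ → ∀ k N : ℕ, 0 < k → k < N →
      ∀ T_L T_R : ℝ, 0 < T_L → 0 < T_R →
        ∃ S : MarkovSemigroupFor
            ((cellChain ω₂ lam β γ (fun i => decide (i < k))).generator N T_L T_R),
          (∀ (t : ℝ≥0) (g : PhaseSpace N →ᵇ ℝ), Continuous fun x => ∫ y, g y ∂(S.kernel t x)) ∧
          ∃ (x₀ : PhaseSpace N) (C : ℝ≥0), ∀ n : ℕ,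
            ∫⁻ s in Set.Ioc (0 : ℝ) (n + 1),
                ∫⁻ y, ENNReal.ofReal
                  ((1 + (cellChain ω₂ lam β γ (fun i => decide (i < k))).hamiltonian N y) ^ 2)
                  ∂(S.kernel s.toNNReal x₀) ≤ ((n : ℝ≥0∞) + 1) * C := by
  intro ω₂ lam β γ hω hl hβ hγ k N hk hkN T_L T_R hL hR
  obtain ⟨S, hFeller, hker⟩ := cellChain_exists_fellerSemigroup hω hl.le hβ.le hγ.le
    (fun i => decide (i < k)) (lt_of_le_of_lt (Nat.zero_le k) hkN) hL.le hR.le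
  obtain ⟨x₀, C, hC⟩ := Summit.AtomisticToContinuum.FouriersLaw.Theorems.PrefixSteadyStates.LineRegistered.stub_prefixCesaroEnergyBoundR17 ω₂ lam β γ hω hl hβ hγ k N hk hkN T_L T_R hL hR
  refine ⟨S, hFeller, x₀, C, fun n => ?_⟩
  simp only [hker]
  exact hC n

/-- **Uniqueness in the weak class on the MIXED rungs** (the r2–r4 stub U₊, now PROVED from the three
kernel-level stubs): two weak steady states have smooth densities (U-a), are invariant for the Langevin
kernels (U-b), hence coincide (U-c). -/
theorem prefixUniquenessPos_of_stubs :
    ∀ ω₂ lam β γ : ℝ, 0 < ω₂ → 0 < lam → 0 < β → 0 < γ → ∀ k N : ℕ, 0 < k → k < N →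
      ∀ T_L T_R : ℝ, 0 < T_L → 0 < T_R →
        ∀ μ ν : Measure (PhaseSpace N),
          (cellChain ω₂ lam β γ (fun i => decide (i < k))).IsSteadyState N T_L T_R μ →
          (cellChain ω₂ lam β γ (fun i => decide (i < k))).IsSteadyState N T_L T_R ν → μ = ν := by
  intro ω₂ lam β γ hω hl hβ hγ k N _hk hkN T_L T_R hL hR μ ν hμ hν
  have hN : 0 < N := lt_of_le_of_lt (Nat.zero_le k) hkN
  haveI := hμ.1
  haveI := hν.1
  exact Summit.AtomisticToContinuum.FouriersLaw.Theorems.PrefixSteadyStates.LineRegistered.stub_cellChainInvariantUnique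
    ω₂ lam β γ hω hl.le hβ.le hγ (fun i => decide (i < k)) N hN T_L T_R hL hR.le μ ν hμ.1 hν.1
    (Summit.AtomisticToContinuum.FouriersLaw.Theorems.PrefixSteadyStates.LineRegistered.stub_cellChainInvariantOfSteadyState
      ω₂ lam β γ hω hl.le hβ.le hγ _ N hN T_L T_R hL hR μ hμ
      (Summit.AtomisticToContinuum.FouriersLaw.Theorems.PrefixSteadyStates.LineRegistered.stub_cellChainSmoothDensity
        ω₂ lam β γ hω hl.le hβ.le hγ _ N hN T_L T_R hL hR μ hμ))
    (Summit.AtomisticToContinuum.FouriersLaw.Theorems.PrefixSteadyStates.LineRegistered.stub_cellChainInvariantOfSteadyState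
      ω₂ lam β γ hω hl.le hβ.le hγ _ N hN T_L T_R hL hR ν hν
      (Summit.AtomisticToContinuum.FouriersLaw.Theorems.PrefixSteadyStates.LineRegistered.stub_cellChainSmoothDensity
        ω₂ lam β γ hω hl.le hβ.le hγ _ N hN T_L T_R hL hR ν hν))

/-! `stub_prefixMixingOfDecay` (Stub M, r12: uniform Harris — decay + (3.4) ⇒ CEHR (2.5) uniformly in the
bias, with invariant probability measures) is LANDED: p155758,
`Summits/AtomisticToContinuum/FouriersLaw/Theorems/MatthiessenLadderPrefixSteadyStatesStubPrefixMixingOfDecay.lean`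
(+ Literature ConfinedLocalMinorizationUniform p154851, SiteChainUniformReach p154945, SiteChainUniformMinorization
p155415), imported above. -/

/-- **Finite response of the unique steady state on the MIXED rungs** (the r2–r6 stub R₊, now PROVED
from `prefixUniformMixing_of_stubs` + the LANDED `stub_prefixResponseOfUniformMixing`). -/
theorem prefixResponseOfUniquePos_of_stubs :
    ∀ ω₂ lam β γ : ℝ, 0 < ω₂ → 0 < lam → 0 < β → 0 < γ → ∀ k N : ℕ, 0 < k → k < N →
      (∀ T_L T_R : ℝ, 0 < T_L → 0 < T_R →
        ∃ μ : Measure (PhaseSpace N),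
          (cellChain ω₂ lam β γ (fun i => decide (i < k))).IsSteadyState N T_L T_R μ ∧
          ∀ ν : Measure (PhaseSpace N),
            (cellChain ω₂ lam β γ (fun i => decide (i < k))).IsSteadyState N T_L T_R ν → ν = μ) →
      ∀ T : ℝ, 0 < T →
        ∃ D : ℝ, (cellChain ω₂ lam β γ (fun i => decide (i < k))).IsResponseCoeff N T D :=
  fun ω₂ lam β γ hω hl hβ hγ k N hk hkN hEU T hT =>
    Summit.AtomisticToContinuum.FouriersLaw.Theorems.PrefixSteadyStates.LineRegistered.stub_prefixResponseOfUniformMixing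
      ω₂ lam β γ hω hl hβ hγ k N hk hkN hEU T hT (Summit.AtomisticToContinuum.FouriersLaw.Theorems.PrefixSteadyStates.LineRegistered.stub_prefixUniformMixingR17 ω₂ lam β γ hω hl hβ hγ k N hk hkN T hT)

/-! ### The harmonic regime `k = 0`: the rung IS the pinned harmonic host (proved, no sorry) -/

/-- The `k = 0` cell indicator is identically `false`. -/
theorem decide_lt_zero_eq : (fun i : ℕ => decide (i < 0)) = fun _ => false := by
  funext i; simp

/-- The `k = 0` rung IS the pinned harmonic host `pinnedChain ω₂ 0 0 γ` (as a site chain). -/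
theorem cellChain_lt_zero_eq (ω₂ lam β γ : ℝ) :
    cellChain ω₂ lam β γ (fun i => decide (i < 0)) = (pinnedChain ω₂ 0 0 γ).toSiteChain := by
  rw [decide_lt_zero_eq, cellChain_const_false]

/-- Steady states of the `k = 0` rung are those of the pinned harmonic chain. -/
theorem isSteadyState_prefix_zero (ω₂ lam β γ : ℝ) (N : ℕ) :
    (cellChain ω₂ lam β γ (fun i => decide (i < 0))).IsSteadyState N =
      (pinnedChain ω₂ 0 0 γ).IsSteadyState N := by
  rw [cellChain_lt_zero_eq, OscillatorChain.toSiteChain_isSteadyState]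

/-! ### The saturated regime `N ≤ k`: the rung IS the pinned chain (proved, no sorry) -/

/-- For `N ≤ k` every cell below `N` is switched on, so the steady-state predicate of the prefix
rung at size `N` is literally that of `pinnedChain ω₂ lam β γ`. -/
theorem isSteadyState_prefix_of_le (ω₂ lam β γ : ℝ) {k N : ℕ} (h : N ≤ k) :
    (cellChain ω₂ lam β γ (fun i => decide (i < k))).IsSteadyState N =
      (pinnedChain ω₂ lam β γ).IsSteadyState N := by
  rw [cellChain_isSteadyState_congr ω₂ lam β γ (c := fun i => decide (i < k)) (c' := fun _ => true)
      (fun i hi => by simp [lt_of_lt_of_le hi h]), cellChain_const_true,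
    OscillatorChain.toSiteChain_isSteadyState]

/-- For `N ≤ k` the response coefficients of the prefix rung at size `N` are those of the pinned
chain (as a site chain). -/
theorem isResponseCoeff_prefix_of_le (ω₂ lam β γ : ℝ) {k N : ℕ} (h : N ≤ k) :
    (cellChain ω₂ lam β γ (fun i => decide (i < k))).IsResponseCoeff N =
      (pinnedChain ω₂ lam β γ).toSiteChain.IsResponseCoeff N := by
  rw [cellChain_isResponseCoeff_congr ω₂ lam β γ (c := fun i => decide (i < k)) (c' := fun _ => true)
      (fun i hi => by simp [lt_of_lt_of_le hi h]), cellChain_const_true]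

/-- Response coefficients of a homogeneous chain viewed as a site chain, unfolded (`Iff.rfl`). -/
theorem isResponseCoeff_toSiteChain_iff (P : OscillatorChain) (N : ℕ) (T D : ℝ) :
    P.toSiteChain.IsResponseCoeff N T D ↔
      ∃ μ : ℝ → ℝ → Measure (PhaseSpace N),
        (∀ T_L T_R : ℝ, 0 < T_L → 0 < T_R → P.IsSteadyState N T_L T_R (μ T_L T_R)) ∧
        Tendsto (fun δ : ℝ => P.totalCurrent (μ (T + δ / 2) (T - δ / 2)) / δ) (𝓝[≠] 0) (𝓝 D) :=
  Iff.rfl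

/-- The pinned chain has a response coefficient at every size and temperature: canonical
steady-state family by choice (`pinnedChain_exists_isSteadyState`, PROVED), weak-NESS uniqueness
(`NessUnique_holds`, PROVED) and the finite-`N` response theorem
(`FourierGreenKubo.finiteResponse_of_unique`, PROVED). -/
theorem pinnedChain_exists_isResponseCoeff {ω₂ lam β γ : ℝ} (hω : 0 < ω₂) (hl : 0 < lam)
    (hβ : 0 < β) (hγ : 0 < γ) (N : ℕ) {T : ℝ} (hT : 0 < T) :
    ∃ D : ℝ, (pinnedChain ω₂ lam β γ).toSiteChain.IsResponseCoeff N T D := by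
  classical
  -- uniqueness of weak steady states of the pinned chain (in tree)
  have hU : ∀ (M : ℕ) (T_L T_R : ℝ), 0 < T_L → 0 < T_R →
      ∀ μ ν : Measure (PhaseSpace M), (pinnedChain ω₂ lam β γ).IsSteadyState M T_L T_R μ →
        (pinnedChain ω₂ lam β γ).IsSteadyState M T_L T_R ν → μ = ν :=
    Summit.AtomisticToContinuum.FouriersLaw.Theses.MatthiessenLadder.NessUnique_holds
      ω₂ lam β γ hω hl hβ hγ
  -- the canonical steady-state family at every size (choice over the in-tree existence theorem)
  let μ₀ : (M : ℕ) → ℝ → ℝ → Measure (PhaseSpace M) := fun M T_L T_R =>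
    if h : 0 < T_L ∧ 0 < T_R then
      Classical.choose (pinnedChain_exists_isSteadyState hω hl hβ hγ M h.1 h.2) else 0
  have hμ₀ : ∀ (M : ℕ) (T_L T_R : ℝ), 0 < T_L → 0 < T_R →
      (pinnedChain ω₂ lam β γ).IsSteadyState M T_L T_R (μ₀ M T_L T_R) := by
    intro M T_L T_R h1 h2
    have h12 : 0 < T_L ∧ 0 < T_R := ⟨h1, h2⟩
    simp only [μ₀, dif_pos h12]
    exact Classical.choose_spec (pinnedChain_exists_isSteadyState hω hl hβ hγ M h1 h2)
  obtain ⟨D, hD⟩ :=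
    Summit.AtomisticToContinuum.FouriersLaw.Theorems.FourierGreenKubo.finiteResponse_of_unique
      ω₂ lam β γ hω hl hβ hγ hU μ₀ hμ₀ T hT N
  exact ⟨D, (isResponseCoeff_toSiteChain_iff _ N T D).2
    ⟨μ₀ N, fun T_L T_R h1 h2 => hμ₀ N T_L T_R h1 h2, hD⟩⟩

/-! ### The three clauses on all proper prefixes `k < N`, from the stubs -/

/-- **Existence on the proper prefixes** (PROVED from the stubs): `k = 0` is the Gaussian
`harmonicNESS` (in tree); `0 < k < N` is `cellChain_exists_fellerSemigroup` + `prefixCesaroEnergyBound_of_stubs`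
(`prefixSemigroupEnergyBound_of_stubs`) fed into the LANDED `stub_steadyStateOfSemigroupBound`
(Krylov–Bogoliubov + Dynkin, p146884). -/
theorem prefixExistence_of_stubs :
    ∀ ω₂ lam β γ : ℝ, 0 < ω₂ → 0 < lam → 0 < β → 0 < γ → ∀ k N : ℕ, k < N →
      ∀ T_L T_R : ℝ, 0 < T_L → 0 < T_R →
        ∃ μ : Measure (PhaseSpace N),
          (cellChain ω₂ lam β γ (fun i => decide (i < k))).IsSteadyState N T_L T_R μ := by
  intro ω₂ lam β γ hω hl hβ hγ k N hkN T_L T_R hL hR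
  rcases Nat.eq_zero_or_pos k with rfl | hk
  · rw [isSteadyState_prefix_zero]
    exact ⟨_, isSteadyState_harmonicNESS hω hγ N hL hR⟩
  · exact Summit.AtomisticToContinuum.FouriersLaw.Theorems.PrefixSteadyStates.LineRegistered.stub_steadyStateOfSemigroupBound
      ω₂ lam β γ hω hl.le hβ.le (fun i => decide (i < k)) N T_L T_R
      (prefixSemigroupEnergyBound_of_stubs ω₂ lam β γ hω hl hβ hγ k N hk hkN T_L T_R hL hR)

/-- **Uniqueness on the proper prefixes** (PROVED from the stubs): `k = 0` is the LANDED
`stub_harmonicNessUnique` transported along `cellChain_const_false`; `0 < k < N` is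
`prefixUniquenessPos_of_stubs` (U-a + U-b + U-c). -/
theorem prefixUniqueness_of_stubs :
    ∀ ω₂ lam β γ : ℝ, 0 < ω₂ → 0 < lam → 0 < β → 0 < γ → ∀ k N : ℕ, k < N →
      ∀ T_L T_R : ℝ, 0 < T_L → 0 < T_R →
        ∀ μ ν : Measure (PhaseSpace N),
          (cellChain ω₂ lam β γ (fun i => decide (i < k))).IsSteadyState N T_L T_R μ →
          (cellChain ω₂ lam β γ (fun i => decide (i < k))).IsSteadyState N T_L T_R ν → μ = ν := by
  intro ω₂ lam β γ hω hl hβ hγ k N hkN T_L T_R hL hR μ ν hμ hν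
  rcases Nat.eq_zero_or_pos k with rfl | hk
  · rw [isSteadyState_prefix_zero] at hμ hν
    exact Summit.AtomisticToContinuum.FouriersLaw.Theorems.PrefixSteadyStates.LineRegistered.stub_harmonicNessUnique
      ω₂ γ hω hγ N T_L T_R hL hR μ ν hμ hν
  · exact prefixUniquenessPos_of_stubs ω₂ lam β γ hω hl hβ hγ k N hk hkN T_L T_R hL hR μ ν hμ hν

/-- **Response on the proper prefixes** (PROVED from the stubs): `k = 0` is the LANDED
`stub_prefixResponseZero` (no uniqueness needed); `0 < k < N` is `prefixResponseOfUniquePos_of_stubs`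
(R-hard + R-soft) under existence + uniqueness at size `N`. -/
theorem prefixResponse_of_stubs :
    ∀ ω₂ lam β γ : ℝ, 0 < ω₂ → 0 < lam → 0 < β → 0 < γ → ∀ k N : ℕ, k < N →
      (∀ T_L T_R : ℝ, 0 < T_L → 0 < T_R →
        ∃ μ : Measure (PhaseSpace N),
          (cellChain ω₂ lam β γ (fun i => decide (i < k))).IsSteadyState N T_L T_R μ ∧
          ∀ ν : Measure (PhaseSpace N),
            (cellChain ω₂ lam β γ (fun i => decide (i < k))).IsSteadyState N T_L T_R ν → ν = μ) →
      ∀ T : ℝ, 0 < T →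
        ∃ D : ℝ, (cellChain ω₂ lam β γ (fun i => decide (i < k))).IsResponseCoeff N T D := by
  intro ω₂ lam β γ hω hl hβ hγ k N hkN hEU T hT
  rcases Nat.eq_zero_or_pos k with rfl | hk
  · exact Summit.AtomisticToContinuum.FouriersLaw.Theorems.PrefixSteadyStates.LineRegistered.stub_prefixResponseZero
      ω₂ lam β γ hω hγ N T hT
  · exact prefixResponseOfUniquePos_of_stubs ω₂ lam β γ hω hl hβ hγ k N hk hkN hEU T hT

/-! ### The composition: stubs ⟹ the crux, by name -/

/-- **The composition (PROVED, no `sorry` outside the stubs, axioms `propext`, `Classical.choice`,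
`Quot.sound`).** Proper prefixes `k < N`: existence and uniqueness (`prefixExistence_of_stubs`,
`prefixUniqueness_of_stubs`) give clause (1), which is exactly the hypothesis under which
`prefixResponse_of_stubs` gives the response coefficient. Saturated rungs `N ≤ k`: the rung is the
pinned chain at size `N`, and all three clauses are in-tree theorems
(`pinnedChain_exists_isSteadyState`, `NessUnique_holds`, `finiteResponse_of_unique` via
`pinnedChain_exists_isResponseCoeff`). -/
theorem prefixSteadyStates_of_clauses
    (hE : ∀ ω₂ lam β γ : ℝ, 0 < ω₂ → 0 < lam → 0 < β → 0 < γ → ∀ k N : ℕ, k < N →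
      ∀ T_L T_R : ℝ, 0 < T_L → 0 < T_R →
        ∃ μ : Measure (PhaseSpace N),
          (cellChain ω₂ lam β γ (fun i => decide (i < k))).IsSteadyState N T_L T_R μ)
    (hU : ∀ ω₂ lam β γ : ℝ, 0 < ω₂ → 0 < lam → 0 < β → 0 < γ → ∀ k N : ℕ, k < N →
      ∀ T_L T_R : ℝ, 0 < T_L → 0 < T_R →
        ∀ μ ν : Measure (PhaseSpace N),
          (cellChain ω₂ lam β γ (fun i => decide (i < k))).IsSteadyState N T_L T_R μ →
          (cellChain ω₂ lam β γ (fun i => decide (i < k))).IsSteadyState N T_L T_R ν → μ = ν)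
    (hR : ∀ ω₂ lam β γ : ℝ, 0 < ω₂ → 0 < lam → 0 < β → 0 < γ → ∀ k N : ℕ, k < N →
      (∀ T_L T_R : ℝ, 0 < T_L → 0 < T_R →
        ∃ μ : Measure (PhaseSpace N),
          (cellChain ω₂ lam β γ (fun i => decide (i < k))).IsSteadyState N T_L T_R μ ∧
          ∀ ν : Measure (PhaseSpace N),
            (cellChain ω₂ lam β γ (fun i => decide (i < k))).IsSteadyState N T_L T_R ν → ν = μ) →
      ∀ T : ℝ, 0 < T →
        ∃ D : ℝ, (cellChain ω₂ lam β γ (fun i => decide (i < k))).IsResponseCoeff N T D) :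
    PrefixSteadyStates := by
  intro ω₂ lam β γ hω hl hβ hγ k
  -- clause (1): existence and uniqueness of the weak steady state at every size
  have hEU : ∀ (N : ℕ) (T_L T_R : ℝ), 0 < T_L → 0 < T_R →
      ∃ μ : Measure (PhaseSpace N),
        (cellChain ω₂ lam β γ (fun i => decide (i < k))).IsSteadyState N T_L T_R μ ∧
        ∀ ν : Measure (PhaseSpace N),
          (cellChain ω₂ lam β γ (fun i => decide (i < k))).IsSteadyState N T_L T_R ν → ν = μ := by
    intro N T_L T_R hL hR'
    rcases lt_or_ge k N with hkN | hNk
    · -- proper prefix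
      obtain ⟨μ, hμ⟩ := hE ω₂ lam β γ hω hl hβ hγ k N hkN T_L T_R hL hR'
      exact ⟨μ, hμ, fun ν hν => hU ω₂ lam β γ hω hl hβ hγ k N hkN T_L T_R hL hR' ν μ hν hμ⟩
    · -- saturated rung: the pinned chain (in tree)
      rw [isSteadyState_prefix_of_le ω₂ lam β γ hNk]
      obtain ⟨μ, hμ⟩ := pinnedChain_exists_isSteadyState hω hl hβ hγ N hL hR'
      exact ⟨μ, hμ, fun ν hν =>
        Summit.AtomisticToContinuum.FouriersLaw.Theses.MatthiessenLadder.NessUnique_holds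
          ω₂ lam β γ hω hl hβ hγ N T_L T_R hL hR' ν μ hν hμ⟩
  refine ⟨hEU, fun N T hT => ?_⟩
  -- clause (2): the response coefficient at every size and temperature
  rcases lt_or_ge k N with hkN | hNk
  · exact hR ω₂ lam β γ hω hl hβ hγ k N hkN (hEU N) T hT
  · rw [isResponseCoeff_prefix_of_le ω₂ lam β γ hNk]
    exact pinnedChain_exists_isResponseCoeff hω hl hβ hγ N hT

/-- **`PrefixSteadyStates_of` — the line concludes the crux BY NAME** (the route decl
`Summit.AtomisticToContinuum.FouriersLaw.Theses.MatthiessenLadder.PrefixSteadyStates`) from the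
registered stubs `stub_prefixUniformDecay` (the ONE new-math estimate, CEHR Thm 5.1 for the mixed rung),
`stub_prefixExpBound`, `stub_prefixMixingOfDecay` (ports), and the LANDED stubs `stub_cellChainSmoothDensity` (p149198),
`stub_cellChainInvariantOfSteadyState` (p151514), `stub_cellChainInvariantUnique` (p149382),
`stub_prefixResponseOfUniformMixing` (p152137), the LANDED Literature construction `cellChain_exists_fellerSemigroup`
and the LANDED stubs `stub_steadyStateOfSemigroupBound` (p146884),
`stub_harmonicNessUnique` (p147364), `stub_prefixResponseZero` (p147366) through the sorry-free clauses
and composition above. -/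
theorem PrefixSteadyStates_of : PrefixSteadyStates :=
  prefixSteadyStates_of_clauses prefixExistence_of_stubs prefixUniqueness_of_stubs
    prefixResponse_of_stubs

end Summit.AtomisticToContinuum.FouriersLaw.Theorems.MatthiessenLadderPrefixSteadyStates

end
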